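import Literature.Topology.FourManifolds.LefschetzBasePages
import Literature.Topology.FourManifolds.HandleAttachingMaps
import Literature.Topology.FourManifolds.HandleAttachingMapsAssoc
import Literature.Topology.FourManifolds.Gluing
import HarnessLib

/-!
# Lefschetz handlebodies over the standard base, and one-sided Lefschetz models of closed
# 4-manifolds

Topic `Literature/Topology/FourManifolds`; namespace `Literature.Topology.FourManifolds.LefschetzBase`.
Definitions only (three predicates); NOTHING is asserted.  Sources: A. Kas, Pacific J. Math. 89
(1980) (the handlebody of a Lefschetz fibration over `D²`); J. Harer, *Pencils of curves on
4-manifolds*, thesis (1979); R. E. Gompf, A. I. Stipsicz, *4-Manifolds and Kirby Calculus* (1999),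
§8.2; J. B. Etnyre, T. Fuller, IMRN 2006, §2 and proof of Thm. 1 (p. 8: `X = W ∪ S¹ × D³`);
R. İ. Baykur, AGT 6 (2006), §5.

**Lefschetz handlebodies as data.**  By Kas / Harer / Gompf–Stipsicz §8.2 / Etnyre–Fuller §2, a
(possibly achiral) Lefschetz fibration over `D²` with bounded fibre `F = F_{g,1}` and `n` singular
fibres IS the 2-handlebody `F × D² ∪ h₁ ∪ ⋯ ∪ hₙ`, the `hᵢ` attached along simple closed curves
`γᵢ` (the vanishing cycles) lying in distinct fibres `F × {θᵢ}` of `∂(F × D²)`, in the cyclic order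
of the `θᵢ`, with framing `−1` (positive critical point) or `+1` (negative one) relative to the
framing induced by the fibre.  Over the CONCRETE base `Base g ⊂ ℂ²` of `LefschetzBaseModel.lean` /
`LefschetzBaseRegular.lean` / `LefschetzBasePages.lean` (on paper `F_{g,1} × D²`, pages = fibres of
`Φ = y² − x^{2g+1}` in the flat region, page framing and homology shadow explicit) every clause is
a formula, and the vanishing cycles are recorded by their SHADOWS only — signed integral words
`l : List ((Fin g ⊕ Fin g → ℤ) × Bool)` (= `SignedHurwitz.IntWord g` of
`Literature/GroupTheory/CombinatorialGroupTheory/SignedHurwitzStabilisation.lean`, `true` =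
positive), the classes of the `γᵢ` in `H₁(F_{g,1}; ℤ) = ℤ^{2g}` in the symplectic coordinates fixed
by the `A_{2g}` chain (`shadow`):

* `IsLefschetzLink g l h` — the family `h : Fin n → HandleAttachingMap 3 2 (Base g)` of 2-handle
  attaching maps (`HandleAttachingMaps.lean`, Kosinski's `h̄ : T → M`) realises the word `l` of
  length `n`: pairwise disjoint ranges; the `i`-th attaching circle lies in the page of direction
  `pageDir n i = e^{−2πi(i+½)/n}` (clockwise in `i`, so that `wordProduct l`, first letter outermost,
  is the global monodromy: Akbulut–Ozbagci 2001, §2.3); its shadow is the `i`-th class; the page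
  twisting of the handle framing is `−1` for a positive letter and `+1` for a negative one;
* `IsLefschetzHandlebody g l X` — `X` is the base with these `n` handles attached simultaneously
  (`HandleAttachingMap.IsMultiAttachment`): the (achiral) LEFSCHETZ HANDLEBODY `X(F_{g,1}; l)`;
* `ModelsOn M g l` — the closed 4-manifold `M` is `X ∪_Ψ Base g` (`IsBoundaryGluing`) for a
  Lefschetz handlebody `X` of word `l` and SOME diffeomorphism `Ψ : ∂X ≅ ∂ Base g` (the ONE-SIDED
  HANDLEBODY model);
* `ModelsOnFibred M g l` — the same with the multi-attachment data `D` of `X` exposed and the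
  gluing diffeomorphism PAGE-PRESERVING on the unsurgered part of the seam: a point of `∂X` coming
  from the base (`D.jA a`, `a ∈ ∂ Base g` off the attaching tori) is glued to a point of `∂ Base g`
  with the same page angle, `w(Ψ y) ∈ ℝ_{>0} · w(a)` (so binding to binding, page `θ` to page `θ`):
  the HONEST FIBRED model, in which `M ∖ S¹ × D³` is an achiral Lefschetz fibration over the
  2-sphere `D ∪_{θ ∼ θ} D'` with fibre `F_{g,1}` and Hurwitz word `l` (the fibration of `X` over
  `D` and the projection of the cap over `D'` agree along the seam).

**The two models and Laudenbach–Poénaru.**  Etnyre–Fuller (2006, proof of Thm. 1, p. 8) present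
every closed oriented 4-manifold as `M = W ∪ S¹ × D³` with `W → S²` an achiral Lefschetz
fibration with bounded fibres of connected boundary; cutting the base `S²` into a disc `D`
containing all critical values and a disc `D'`, `W = X(F; l) ∪ (F × D')` and
`(F × D') ∪_{∂F × D'} (S¹ × D³) ≅ F × D²` (the 3-ball `D³` fibres over `D'` with fibre an interval),
so `M ≅ X(F; l) ∪_{Ψ₀} (F × D²)` glued along the natural, page-preserving identification of the
boundaries: this is `ModelsOnFibred M g l` (hence `ModelsOn M g l`).  Conversely `ModelsOn` is
WEAKER: `F × D² ≅ ♮^{2g} S¹ × B³` is the 4-dimensional 1-handlebody, every self-diffeomorphism of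
whose boundary extends over it (Laudenbach–Poénaru 1972; tree fact
`Literature.Topology.FourManifolds.exists_diffeomorph_comp_incl_eq`), so the glued MANIFOLD
`X ∪_Ψ Base g` does not depend on `Ψ` — but the word `l` is the Hurwitz word of a fibration over
`S²` only when the seam open books match, i.e. when the geometric monodromy `μ(l)` of `∂X(F; l)`
is trivial in the mapping class group of the page (a weak model only gives `μ(l)_* = 1` on `H₁`,
from `H₁(∂X) ≅ ℤ^{2g}`); statements that use the closed-up fibration (chirality balance via `d₃`,
Baykur's splitting of the base into `D₊ ∪ D₋`) are therefore filed over `ModelsOnFibred`.  The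
named facts over this vocabulary (existence of fibred models: Etnyre–Fuller Thm. 1 / Prop. 12 with
Baykur's Lemma 1; invariance under signed Hurwitz moves and stabilisation pairs: Baykur §5,
Etnyre–Fuller §2, Gompf–Stipsicz §8.2; Stein realisation of sorted fibred models: Baykur Thm. 5.1,
Akbulut–Ozbagci 2001 Thm. 5) are filed separately; this file asserts nothing.

## References
* A. Kas, *On the handlebody decomposition associated to a Lefschetz fibration*, Pacific J. Math.
  89 (1980), 89–104. [Kas1980]
* R. E. Gompf, A. I. Stipsicz, *4-Manifolds and Kirby Calculus*, GSM 20 (1999), §4.4, §8.2.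
  [GompfStipsicz1999]
* J. B. Etnyre, T. Fuller, *Realizing 4-manifolds as achiral Lefschetz fibrations*, IMRN 2006,
  §2 and §5. [EtnyreFuller2006]
* R. İ. Baykur, *Kähler decomposition of 4-manifolds*, AGT 6 (2006), §5. [Baykur2006]
* F. Laudenbach, V. Poénaru, *A note on 4-dimensional handlebodies*, BSMF 100 (1972).
-/

noncomputable section

open scoped Manifold ContDiff Topology
open Set Function

namespace Literature.Topology.FourManifolds

/-- Local notation: `𝔼 n` is the model Euclidean space `EuclideanSpace ℝ (Fin n)`. -/
local notation "𝔼 " n:arg => EuclideanSpace ℝ (Fin n)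

namespace LefschetzBase

universe u

/-- **A Lefschetz link on the standard base realising the signed word `l`.**  One 2-handle attaching
map per letter, with pairwise disjoint ranges; the `i`-th attaching circle lies in the page of
direction `pageDir n i` (distinct pages, clockwise in `i`), has homology shadow the `i`-th
class, and the handle framing has page twisting `−1` if the letter is positive, `+1` if negative
("framing one less / one more than the framing induced by the fibre"). [cite: EtnyreFuller2006, §2] -/
structure IsLefschetzLink (g : ℕ) (l : List ((Fin g ⊕ Fin g → ℤ) × Bool))
    (h : Fin l.length → HandleAttachingMap 3 2 (Base g)) : Prop where
  /-- the attaching maps have pairwise disjoint ranges -/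
  disjoint : Pairwise fun i j => Disjoint (range (h i).toFun) (range (h j).toFun)
  /-- the `i`-th attaching circle lies in the `i`-th page -/
  mem_page : ∀ (i : Fin l.length) θ, (h i).attachingCircle θ ∈ page g (pageDir l.length i)
  /-- the `i`-th attaching circle has shadow the `i`-th class -/
  shadow_eq : ∀ i, shadow g (h i).attachingCircle (h i).continuous_attachingCircle = (l.get i).1
  /-- page twisting `−1` for positive letters, `+1` for negative letters -/
  twisting_eq : ∀ i,
    pageTwisting g (h i).attachingCircle (h i).attachingFraming = if (l.get i).2 then -1 else 1

/-- **`X` is the (achiral) Lefschetz handlebody `X(F_{g,1}; l)`**: the standard base of genus `g`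
with the 2-handles of a Lefschetz link realising `l` attached simultaneously
(`HandleAttachingMap.IsMultiAttachment`).  By Kas 1980 / Gompf–Stipsicz 1999 §8.2 /
Etnyre–Fuller 2006 §2 these are exactly the total spaces of (achiral) Lefschetz fibrations over `D²`
with fibre `F_{g,1}` and Hurwitz word `l`. [cite: Kas1980] -/
def IsLefschetzHandlebody (g : ℕ) (l : List ((Fin g ⊕ Fin g → ℤ) × Bool)) (X : Type u)
    [TopologicalSpace X] [ChartedSpace (EuclideanHalfSpace 4) X] : Prop :=
  ∃ h : Fin l.length → HandleAttachingMap 3 2 (Base g),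
    IsLefschetzLink g l h ∧ HandleAttachingMap.IsMultiAttachment h (𝓡∂ 4) X

/-- **One-sided Lefschetz model of a closed 4-manifold**: `ModelsOn M g l` — `M` is the boundary
gluing `X ∪_Ψ Base g` (`IsBoundaryGluing`) of a compact Lefschetz handlebody `X` of word `l` over the
genus-`g` base and the base itself, along SOME diffeomorphism `Ψ : ∂X ≅ ∂ Base g` (the result does
not depend on `Ψ`: Laudenbach–Poénaru).  Equivalently (Etnyre–Fuller 2006, proof of Thm. 1): `M`
minus a tubular neighbourhood of a circle is an achiral Lefschetz fibration over `S²` with fibre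
`F_{g,1}` and Hurwitz word `l`. [cite: EtnyreFuller2006, Thm. 1 (proof, p. 8)] -/
def ModelsOn (M : Type) [TopologicalSpace M] [ChartedSpace (𝔼 4) M] (g : ℕ)
    (l : List ((Fin g ⊕ Fin g → ℤ) × Bool)) : Prop :=
  ∃ (X : Type) (_ : TopologicalSpace X) (_ : T2Space X) (_ : SecondCountableTopology X)
    (_ : CompactSpace X) (_ : ChartedSpace (EuclideanHalfSpace 4) X) (_ : IsManifold (𝓡∂ 4) ∞ X)
    (bX : BoundaryData (𝓡∂ 4) X (𝓡 3)) (Ψ : bX.carrier ≃ₘ⟮𝓡 3, 𝓡 3⟯ (bBase g).carrier),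
    IsLefschetzHandlebody g l X ∧ IsBoundaryGluing bX (bBase g) Ψ (𝓡 4) M

/-- **Honest fibred Lefschetz model of a closed 4-manifold**: `ModelsOnFibred M g l` — `M` is
the boundary gluing `X ∪_Ψ Base g` of a compact Lefschetz handlebody `X` of word `l` (with its
multi-attachment data `D`: the embedding `D.jA` of the base minus the attaching spheres and the
handle pieces `D.jB i`) and the base, along a diffeomorphism `Ψ : ∂X ≅ ∂ Base g` which is
PAGE-PRESERVING on the unsurgered part of the seam: if `y ∈ ∂X` is the image `D.jA a` of a boundary
point `a` of the base off the attaching tori, then `w(Ψ y)` is a positive real multiple of `w(a)`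
(same page angle `arg w`; binding `w = 0` to binding).  Then the Lefschetz fibration of `X` over the
disc `D` and the projection `w` of the cap `Base g` over the disc `D'` agree along the seam, and
`M ∖ S¹ × D³` is an achiral Lefschetz fibration over `D ∪_{θ∼θ} D' = S²` with fibre `F_{g,1}` and
Hurwitz word `l`: Etnyre–Fuller's `X = W ∪ S¹ × D³` (2006, proof of Thm. 1, p. 8) read through Kas'
handlebody description.  Radial rescaling and motion inside pages are left free (they are absorbed
by fibred isotopies of the cap). [cite: EtnyreFuller2006, Thm. 1 (proof, p. 8)] -/
def ModelsOnFibred (M : Type) [TopologicalSpace M] [ChartedSpace (𝔼 4) M] (g : ℕ)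
    (l : List ((Fin g ⊕ Fin g → ℤ) × Bool)) : Prop :=
  ∃ (X : Type) (_ : TopologicalSpace X) (_ : T2Space X) (_ : SecondCountableTopology X)
    (_ : CompactSpace X) (_ : ChartedSpace (EuclideanHalfSpace 4) X) (_ : IsManifold (𝓡∂ 4) ∞ X)
    (h : Fin l.length → HandleAttachingMap 3 2 (Base g))
    (D : HandleAttachingMap.MultiAttachmentData h (𝓡∂ 4) X)
    (bX : BoundaryData (𝓡∂ 4) X (𝓡 3)) (Ψ : bX.carrier ≃ₘ⟮𝓡 3, 𝓡 3⟯ (bBase g).carrier),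
    IsLefschetzLink g l h ∧ IsBoundaryGluing bX (bBase g) Ψ (𝓡 4) M ∧
    ∀ (y : bX.carrier) (a : ↥(HandleAttachingMap.coresComplement h)), bX.incl y = D.jA a →
      ∃ c : ℝ, 0 < c ∧ w g ((bBase g).incl (Ψ y)).1 = (c : ℂ) * w g (a : Base g).1

/-! ### API -/

/-- A fibred model is in particular a one-sided handlebody model (forget the page condition and the
choice of multi-attachment data). [folklore] -/
theorem ModelsOnFibred.modelsOn {M : Type} [TopologicalSpace M] [ChartedSpace (𝔼 4) M] {g : ℕ}
    {l : List ((Fin g ⊕ Fin g → ℤ) × Bool)} (hM : ModelsOnFibred M g l) : ModelsOn M g l := by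
  obtain ⟨X, _, _, _, _, _, _, h, D, bX, Ψ, hlink, hglue, -⟩ := hM
  exact ⟨X, inferInstance, inferInstance, inferInstance, inferInstance, inferInstance, inferInstance,
    bX, Ψ, ⟨h, hlink, D.isMultiAttachment⟩, hglue⟩

/-- A Lefschetz link has as many handles as the word has letters (trivial bookkeeping, recorded for
consumers quantifying over `Fin n`). [folklore] -/
theorem IsLefschetzLink.mem_page_dir {g : ℕ} {l : List ((Fin g ⊕ Fin g → ℤ) × Bool)}
    {h : Fin l.length → HandleAttachingMap 3 2 (Base g)} (hl : IsLefschetzLink g l h)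
    (i : Fin l.length) : range (h i).attachingCircle ⊆ page g (pageDir l.length i) := by
  rintro _ ⟨θ, rfl⟩; exact hl.mem_page i θ

/-- The attaching circles of a Lefschetz link lie in the boundary of the base (pages do).
[folklore] -/
theorem IsLefschetzLink.attachingCircle_mem_boundary {g : ℕ} {l : List ((Fin g ⊕ Fin g → ℤ) × Bool)}
    {h : Fin l.length → HandleAttachingMap 3 2 (Base g)} (hl : IsLefschetzLink g l h)
    (i : Fin l.length) (θ) : (h i).attachingCircle θ ∈ (𝓡∂ 4).boundary (Base g) :=
  page_subset_boundary g (norm_pageDir _ _) (hl.mem_page i θ)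

/-- A one-sided model exhibits `M` as a closed gluing of two compact pieces; in particular `M` is
compact. [folklore] -/
theorem ModelsOn.compactSpace {M : Type} [TopologicalSpace M] [ChartedSpace (𝔼 4) M] {g : ℕ}
    {l : List ((Fin g ⊕ Fin g → ℤ) × Bool)} (h : ModelsOn M g l) : CompactSpace M := by
  obtain ⟨X, _, _, _, _, _, _, bX, Ψ, -, hglue⟩ := h
  exact hglue.compactSpace

end LefschetzBase

end Literature.Topology.FourManifolds
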